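import Summits.QuantumFields.BalabanUV.T4Continuum.Support.B13StepEndArithmetic

/-!
# NE5 ∕ U3 — the transport READING `TransportReads` DISCHARGED BY CONSTRUCTION on the assembled step model and on Bałaban's
# carriers OF RECORD: run A's insertion-operator datum READ AT THE TRANSPORTED BACKGROUND (`readAt`), its sharpness, and the
# END faces with the reading binder gone (typer `t4/formal/NE5/DAG.md` v1.4 §2, OPEN SLOT of N50: «`S.D` := N32 read at the
# transported background (⇒ `TransportReads` by `transportReads_of_insOpAt`)»)

Cell `pub-balaban`, unit `b2b-balaban-t4-ne5-formalise-leaf-03` (NE5 formalisation swarm, LEAF PROVER 03, gen 3; rows of this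
lineage: O1-f `B13Base`∕`B13BaseInsDatum`∕`B13BaseWitness`, O2-hist `B13TermHistSecant` + 5 followers; journal INTENT
`B13StepOfRecordReadAt`).  Summits-side NEW WORK under the LEAN PLACEMENT RULE (cell bookkeeping; NOT a Literature module; NO
END-face module of the row owner or of rows O1-c∕O1-e is edited — a NEW module applying `B13Represents.Assembly.transportReads_of_insOpAt`
(leaf-09, p208313) and the landed END faces `B13StepEndArithmetic.exists_ne5_of_record[_insOp]` ∕ `uniform_ne5_of_record`
(leaf-10-g3, p210647) BY NAME).  HONEST FRAMING: rung (B)+1 of the FINITE-VOLUME T⁴ continuum programme — NOT infinite volume,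
NOT a mass gap, NOT the Clay problem, and **NOT A PROOF OF NE5** (NOT PRINTED in [Balaban1987RG1]–[Balaban1989LargeFieldII], which
print ε-UNIFORM bounds, never η-RATES; cell GAPS G-t4-U3-1): every END face below is an IMPLICATION whose analytic wall binders
(the two one-run slice budgets — W3 KIND; the one-run levels L05∕L06 — quoted SHAPES of [Balaban1987RG1] (1.18) p. 263; row NE2's
entry rate with bounded raw suppliers and a margin floor; W4 or the insertion species' envelope ∕ bound ∕ rate; the termwise W2 data
— wall O2; room ×2; signs; the two strict size inequalities) are DISPLAYED HYPOTHESES, asserted nowhere.  HONEST DEPENDENCY (cell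
line, verbatim): continuum YM on T⁴ ⇐ BetaPertH ∧ nine spine estimates (0/9 proved); BetaPertH ⇐ (D1) ∧ (D4) ∧ CAP+tail; G-an2-4
gates asym, D1 and NE2/3/4.

WHERE IT SITS.  Every END face on the assembled model `B13Represents.Assembly.step` and on the model of record
`B13StepOfRecord.step S E₀ cB` (`B13StepEnd.ne5_of_assembly`, `B13StepEndInsOp.ne5_of_record_insOp`,
`B13StepEndArithmetic.uniform_ne5_of_record[_insOp]`, `B13StepSecantEnd.ne5_of_assembly_secant`, leaf-01-g3's
`B13StepOfRecordSecantEnd.ne5_of_record_secant_actNormDecay` p211635) carries as its FIRST binder the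
READING `hT : TransportReads W` — run A's insertion-operator data `D.insOpA g U k` depend on the run-B background `U` only through
the transported background `C.transport U` (how the carriers pair the runs; leaf L01 = `representsA hT`).  It is an
IDENTIFICATION, not an estimate: the OPERATOR half of the same reading is already BY CONSTRUCTION in the assembly
(`Assembly.rawAt g U k := rawA g (C.transport U) k`, RULE R4 of the owner's design `B13StepDesign.md`), and leaf-09 recorded the
insertion half's discharge pattern `transportReads_of_insOpAt` («the form row O1-c's instantiation takes, RULE R4 ∕ Q3»).  THIS
FILE builds that form once and for all: the insertion datum `readAt D ι` whose run-A insertion-operator data ARE a run-A datum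
`ι : (ℕ → ℝ) → C.BgA → ℕ → IOp` read at `C.transport U`; on it the reading holds by `rfl` on EVERY window, and the sharpness lemma
says nothing is lost — `TransportReads W` IS the statement that `insOpA g · k` factors through `C.transport` for `g ∈ W`.

WHAT IS PROVED (kernel; `[folklore]` throughout; two small `def`s, no `def … : Prop`, no estimate):
* §1 `readAt D ι` (O1-c's `InsDatum` with `insOpA g U k := ι g (C.transport U) k`; every other field — `base`, `slice`, `ω`,
  `insOpB` — unchanged, `rfl`), `readAtAssembly 𝔄 ι` (`{𝔄 with D := readAt 𝔄.D ι}`); **`transportReads_readAt`**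
  (`∀ W, (readAtAssembly 𝔄 ι).TransportReads W`, by `transportReads_of_insOpAt`); SHARPNESS **`transportReads_iff_factorsThrough`**
  (`𝔄.TransportReads W ↔ ∀ g ∈ W, ∀ k, (fun U ↦ 𝔄.D.insOpA g U k).FactorsThrough C.transport`, `Iff.rfl` in substance) and
  **`transportReads_iff_exists_readAt`** (`[Nonempty IOp]`: `𝔄.TransportReads W ↔ ∃ ι, ∀ g ∈ W, ∀ U k, 𝔄.D.insOpA g U k =
  ι g (C.transport U) k` — on the window the datum IS of the read-at form); the hypothesis-free L01 `representsA_readAt` and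
  `eq_outA_readAt` on the assembled model.
* §2 ON BAŁABAN's CARRIERS OF RECORD: `readAtSlots S ι` (`{S with D := readAt S.D ι}`), `assembly_readAtSlots`
  (`assembly (readAtSlots S ι) = readAtAssembly (assembly S) ι`, `rfl`), **`transportReads_record_readAt`**, **`representsA_record_readAt`**
  (L01 on the record model with NO hypothesis), `represents_record_readAt` (MI-R = L01 ∧ L02, hypothesis-free).
* §3 THE END FACES WITH THE READING GONE: **`exists_ne5_of_record_readAt`** ∕ **`exists_ne5_of_record_insOp_readAt`**
  (leaf-10-g3's `exists_ne5_of_record[_insOp]` at `readAtSlots S ι`, `hT` supplied by §2) and **`uniform_ne5_of_record_readAt`**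
  (`∃ C₅, ∀ R S ι W …` — ONE constant for every pair of runs, every slot package READ AT TRANSPORT, every window: the binder list of
  `uniform_ne5_of_record` minus `TransportReads`).  The secant END of record (`B13StepOfRecordSecantEnd`, 30-odd binders) is not restated: its
  `hT` is supplied at the call site by `transportReads_record_readAt S ι W` in one token.
CENSUS VALUE (numbers, not adjectives): on slot packages of the read-at form the displayed binder list of the END of record loses
exactly ONE entry (the reading) and gains NONE; every remaining displayed binder is analytic (two slice budgets, two levels, NE2's
entry rate + 2 raw bounds + floor, W4 or 3 insertion-species data, 3 termwise W2 data, 2 rooms, signs, 2 strict size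
inequalities).  Nothing is asserted about [II]'s kernels ∕ potentials ∕ terms (the slots stay PARAMETERS; `ι` is a parameter);
0 sorry; axioms ⊆ {propext, Classical.choice, Quot.sound}.
-/

noncomputable section

open Metric Set

namespace Summit.QuantumFields.BalabanUV.T4Continuum.B13StepOfRecordReadAt

open Literature.MathematicalPhysics.QuantumFieldTheory.Balaban1983to89
open Literature.MathematicalPhysics.QuantumFieldTheory.Balaban1983to89.T4OutputRate (Carriers Functional DecayBound NE5)
open Literature.MathematicalPhysics.QuantumFieldTheory.Balaban1983to89.T4InputCauchyRateData (StepModel)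
open Literature.MathematicalPhysics.QuantumFieldTheory.Balaban1983to89.T4InputCauchyRateSpecies (ballClass)
open Literature.MathematicalPhysics.QuantumFieldTheory.Balaban1983to89.T4InputCauchyRateTermwise
  (TermBound TermBudget TermLineAnalytic)
open Summit.QuantumFields.BalabanUV.T4Continuum.B13Carriers (TwoRuns)
open Summit.QuantumFields.BalabanUV.T4Continuum.B13OpDatum (OpDatum)
open Summit.QuantumFields.BalabanUV.T4Continuum.B13OpDatumJunctions (RawBounded WeightedEntrywiseRate)
open Summit.QuantumFields.BalabanUV.T4Continuum.B13HistInsertion (InsDatum)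
open Summit.QuantumFields.BalabanUV.T4Continuum.B13StepTermLabels (TermIdx)
open Summit.QuantumFields.BalabanUV.T4Continuum.B13StepTermFamily (term)
open Summit.QuantumFields.BalabanUV.T4Continuum.B13InnerData (Bnd)
open Summit.QuantumFields.BalabanUV.T4Continuum.B13Base (selfCtr)
open Summit.QuantumFields.BalabanUV.T4Continuum.B13Represents (Assembly)
open Summit.QuantumFields.BalabanUV.T4Continuum.B13StepOfRecord (Slots assembly step outA outB)
open Summit.QuantumFields.BalabanUV.T4Continuum.B13StepEndArithmetic
  (exists_ne5_of_record exists_ne5_of_record_insOp uniform_ne5_of_record)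

/-! ## §1 The insertion datum READ AT THE TRANSPORTED BACKGROUND; the reading by construction; sharpness -/

section Generic

variable {C : Carriers} {IOp Hist : Type*} [NormedAddCommGroup Hist] [NormedSpace ℂ Hist]

/-- [folklore] DATA (no inequality inside): the insertion datum `D` with run A's insertion-operator data REPLACED by a RUN-A datum
`ι : (ℕ → ℝ) → C.BgA → ℕ → IOp` READ AT THE TRANSPORTED BACKGROUND, `insOpA g U k := ι g (C.transport U) k` — the insertion twin
of `B13Represents.Assembly.rawAt` (RULE R4).  `base`, `slice`, `ω`, `insOpB` are `D`'s. -/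
def readAt (D : InsDatum C IOp Hist) (ι : (ℕ → ℝ) → C.BgA → ℕ → IOp) : InsDatum C IOp Hist :=
  { D with insOpA := fun g U k => ι g (C.transport U) k }

variable (D : InsDatum C IOp Hist) (ι : (ℕ → ℝ) → C.BgA → ℕ → IOp)

/-- [folklore] Run A's insertion-operator data of `readAt D ι` ARE `ι` at the transported background (`rfl`). -/
theorem readAt_insOpA (g : ℕ → ℝ) (U : C.BgB) (k : ℕ) : (readAt D ι).insOpA g U k = ι g (C.transport U) k := rfl
/-- [folklore] Run B's insertion-operator data are unchanged (`rfl`). -/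
theorem readAt_insOpB : (readAt D ι).insOpB = D.insOpB := rfl
/-- [folklore] The table-independent part is unchanged (`rfl`). -/
theorem readAt_base : (readAt D ι).base = D.base := rfl
/-- [folklore] The age-free slices are unchanged (`rfl`). -/
theorem readAt_slice : (readAt D ι).slice = D.slice := rfl
/-- [folklore] The age damping is unchanged (`rfl`). -/
theorem readAt_ω : (readAt D ι).ω = D.ω := rfl
/-- [folklore] Run B's insertion maps are unchanged (`rfl`). -/
theorem readAt_insB : (readAt D ι).insB = D.insB := rfl
/-- [folklore] Run A's insertion maps: the insertion read at `ι g (C.transport U) k` (`rfl`). -/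
theorem readAt_insA (g : ℕ → ℝ) (U : C.BgB) (k : ℕ) (t : C.Dom → ℝ) :
    (readAt D ι).insA g U k t = D.ins k (ι g (C.transport U) k) t := rfl

end Generic

section GenericAssembly

variable {C : Carriers} {E IOp Hist ι' P J : Type*} [NormedAddCommGroup Hist] [NormedSpace ℂ Hist]
  (𝔄 : Assembly C E IOp Hist ι' P J)

/-- [folklore] DATA: the assembly with its insertion datum read at the transported background (every other field unchanged). -/
def readAtAssembly (ι : (ℕ → ℝ) → C.BgA → ℕ → IOp) : Assembly C E IOp Hist ι' P J := { 𝔄 with D := readAt 𝔄.D ι }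

variable (ι : (ℕ → ℝ) → C.BgA → ℕ → IOp)

/-- [folklore] The insertion datum of the read-at assembly (`rfl`). -/
theorem readAtAssembly_D : (readAtAssembly 𝔄 ι).D = readAt 𝔄.D ι := rfl

/-- [folklore] **THE READING BY CONSTRUCTION, ON EVERY WINDOW**: for the read-at assembly `TransportReads W` holds with no
hypothesis (leaf-09's `transportReads_of_insOpAt` with `rfl`). -/
theorem transportReads_readAt (W : Set (ℕ → ℝ)) : (readAtAssembly 𝔄 ι).TransportReads W :=
  (readAtAssembly 𝔄 ι).transportReads_of_insOpAt (insOpA' := ι) (fun _ _ _ => rfl) W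

/-- [folklore] **SHARPNESS (i)**: the reading IS the statement that, for every coupling sequence in the window and every step, run
A's insertion-operator data as a function of the run-B background FACTOR THROUGH the transport (`Function.FactorsThrough`,
definitional unfolding). -/
theorem transportReads_iff_factorsThrough (W : Set (ℕ → ℝ)) :
    𝔄.TransportReads W ↔ ∀ g ∈ W, ∀ k, (fun U => 𝔄.D.insOpA g U k).FactorsThrough C.transport :=
  ⟨fun h g hg k _ _ hUU' => h g hg _ _ hUU' k, fun h g hg _ _ hUU' k => h g hg k hUU'⟩

/-- [folklore] **SHARPNESS (ii)**: on the window, the reading holds IFF run A's insertion-operator data ARE of the read-at form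
for SOME run-A datum `ι` — the construction `readAt` loses no generality (`Function.FactorsThrough.extend`-type choice; the
insertion-operator type is inhabited). -/
theorem transportReads_iff_exists_readAt [Nonempty IOp] (W : Set (ℕ → ℝ)) :
    𝔄.TransportReads W ↔ ∃ ι : (ℕ → ℝ) → C.BgA → ℕ → IOp, ∀ g ∈ W, ∀ (U : C.BgB) (k : ℕ), 𝔄.D.insOpA g U k = ι g (C.transport U) k := by
  classical
  refine ⟨fun h => ?_, fun ⟨ι, hι⟩ g hg U U' hUU' k => by rw [hι g hg, hι g hg, hUU']⟩
  refine ⟨fun g a k => if g ∈ W then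
      Function.extend C.transport (fun U => 𝔄.D.insOpA g U k) (fun _ => Classical.arbitrary IOp) a
    else Classical.arbitrary IOp, fun g hg U k => ?_⟩
  simp only [if_pos hg]
  exact (((transportReads_iff_factorsThrough 𝔄 W).mp h g hg k).extend_apply _ U).symm

variable (BHist : ℕ → ℝ)

/-- [folklore] **L01 WITH NO HYPOTHESIS** for the read-at assembly: the recursively defined run-A output satisfies `RepresentsA`
on every window. -/
theorem representsA_readAt (W : Set (ℕ → ℝ)) :
    ((readAtAssembly 𝔄 ι).step BHist).RepresentsA ((readAtAssembly 𝔄 ι).outA BHist) W :=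
  (readAtAssembly 𝔄 ι).representsA BHist (transportReads_readAt 𝔄 ι W)

/-- [folklore] L01 is definitional for the read-at assembly: any represented run-A functional IS `outA` at transported
backgrounds, on every window. -/
theorem eq_outA_readAt {W : Set (ℕ → ℝ)} {EA : Functional C C.BgA}
    (hEA : ((readAtAssembly 𝔄 ι).step BHist).RepresentsA EA W) {g : ℕ → ℝ} (hg : g ∈ W) (U : C.BgB) (X : C.Dom) :
    EA g (C.transport U) X = (readAtAssembly 𝔄 ι).outA BHist g (C.transport U) X :=
  (readAtAssembly 𝔄 ι).eq_outA BHist (transportReads_readAt 𝔄 ι W) hEA hg U X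

end GenericAssembly

/-! ## §2 On Bałaban's carriers OF RECORD: the slot package read at transport -/

section OfRecord

variable {𝔾 : Type} [GaugeGroup 𝔾] {R : TwoRuns 𝔾} {E IOp Hist : Type*} [NormedAddCommGroup Hist] [NormedSpace ℂ Hist]

/-- [folklore] DATA: the slot package `S` of the instancer with its insertion datum read at the transported background
`R.carriers.transport` (one block averaging + level identification, `B13Carriers.transportRaw`). -/
def readAtSlots (S : Slots R E IOp Hist) (ι : (ℕ → ℝ) → R.carriers.BgA → ℕ → IOp) : Slots R E IOp Hist :=
  { S with D := readAt S.D ι }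

variable (S : Slots R E IOp Hist) (ι : (ℕ → ℝ) → R.carriers.BgA → ℕ → IOp) (E₀ cB : ℝ)

/-- [folklore] The assembly of record of the read-at slots IS the read-at assembly of record (`rfl`). -/
theorem assembly_readAtSlots : assembly (readAtSlots S ι) = readAtAssembly (assembly S) ι := rfl

/-- [folklore] The insertion datum ∕ age damping of the read-at slots (`rfl`). -/
theorem readAtSlots_D : (readAtSlots S ι).D = readAt S.D ι := rfl
/-- [folklore] -/
theorem readAtSlots_ω : (readAtSlots S ι).D.ω = S.D.ω := rfl

/-- [folklore] **THE READING ON THE CARRIERS OF RECORD, BY CONSTRUCTION, ON EVERY WINDOW.** -/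
theorem transportReads_record_readAt (W : Set (ℕ → ℝ)) : (assembly (readAtSlots S ι)).TransportReads W :=
  transportReads_readAt (assembly S) ι W

/-- [folklore] **L01 ON THE CARRIERS OF RECORD WITH NO HYPOTHESIS** (slot package read at transport). -/
theorem representsA_record_readAt (W : Set (ℕ → ℝ)) :
    (step (readAtSlots S ι) E₀ cB).RepresentsA (outA (readAtSlots S ι) E₀ cB) W :=
  B13StepOfRecord.representsA (readAtSlots S ι) E₀ cB (transportReads_record_readAt S ι W)

/-- [folklore] L01 is definitional on the carriers of record (slot package read at transport): a represented run-A functional IS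
`outA` at transported backgrounds. -/
theorem eq_outA_record_readAt {W : Set (ℕ → ℝ)} {EA : Functional R.carriers R.carriers.BgA}
    (hEA : (step (readAtSlots S ι) E₀ cB).RepresentsA EA W) {g : ℕ → ℝ} (hg : g ∈ W) (U : R.carriers.BgB) (X : R.carriers.Dom) :
    EA g (R.carriers.transport U) X = outA (readAtSlots S ι) E₀ cB g (R.carriers.transport U) X :=
  B13StepOfRecord.eq_outA (readAtSlots S ι) E₀ cB (transportReads_record_readAt S ι W) hEA hg U X

/-- [folklore] **MI-R (L01 ∧ L02) ON THE CARRIERS OF RECORD WITH NO HYPOTHESIS** (slot package read at transport). -/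
theorem represents_record_readAt (W : Set (ℕ → ℝ)) :
    (step (readAtSlots S ι) E₀ cB).RepresentsA (outA (readAtSlots S ι) E₀ cB) W ∧
      (step (readAtSlots S ι) E₀ cB).RepresentsB (outB (readAtSlots S ι) E₀ cB) W :=
  ⟨representsA_record_readAt S ι E₀ cB W, B13StepOfRecord.representsB (readAtSlots S ι) E₀ cB W⟩

/-! ## §3 The END faces of record with the reading binder GONE -/

/-- [folklore] **PER PAIR OF RUNS, READING DISCHARGED**: leaf-10-g3's `B13StepEndArithmetic.exists_ne5_of_record` at the slot
package READ AT TRANSPORT — `∃ C₅, NE5 (outA … E₀ cB) (outB … E₀ cB) W κ θ′ C₅` at the prescribed rate from the DISPLAYED analytic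
binders (two one-run slice budgets — W3 KIND; `DecayBound` ×2 — L05∕L06 SHAPES; `RawBounded` ×2 + row NE2's
`WeightedEntrywiseRate c₁ θ^k` + floor `r₀`; W4 `InsertionRate δ′`; the termwise W2 data on the roomy class — wall O2; room ×2),
the signs, `0 < θ < 1`, `θ ≤ θ′ ≤ 1` and the two strict size inequalities.  NO `TransportReads` binder. -/
theorem exists_ne5_of_record_readAt {W : Set (ℕ → ℝ)} {ROp RHist : ℕ → ℝ} {a : ℕ → TermIdx R.carriers.Dom (Bnd R) → ℝ}
    {κ G EA₀ cA c₁ r₀ δ' θ θ' : ℝ}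
    (hbB : (assembly (readAtSlots S ι)).SliceBudgetB W κ cB)
    (hbA : (readAtSlots S ι).D.SliceBudget (step (readAtSlots S ι) E₀ cB) W κ cA)
    (hdA : DecayBound (outA (readAtSlots S ι) E₀ cB) W EA₀ κ) (hdB : DecayBound (outB (readAtSlots S ι) E₀ cB) W E₀ κ)
    (hRA : RawBounded S.F (assembly (readAtSlots S ι)).rawAt W) (hRB : RawBounded S.F S.rawB W)
    (hwer : WeightedEntrywiseRate S.F (assembly (readAtSlots S ι)).rawAt S.rawB W c₁ fun k => θ ^ k) (hfl : ∀ k, r₀ ≤ S.rOp k)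
    (hins : (step (readAtSlots S ι) E₀ cB).InsertionRate W κ E₀ δ' θ)
    (hbd : TermBound (ballClass (selfCtr (assembly (readAtSlots S ι)).raw (assembly (readAtSlots S ι)).histRef) ROp RHist)
      (term (assembly S).𝒯 (assembly S).inc S.act) W κ a)
    (hbud : TermBudget a G)
    (hline : TermLineAnalytic (ballClass (selfCtr (assembly (readAtSlots S ι)).raw (assembly (readAtSlots S ι)).histRef) ROp RHist)
      (term (assembly S).𝒯 (assembly S).inc S.act) W)
    (hOp : ∀ k, S.rOp k ≤ ROp k) (hHist : ∀ k, (assembly S).bHist E₀ cB k + S.rHist k ≤ RHist k)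
    (hE₀ : 0 ≤ E₀) (hG : 0 ≤ G) (hcA : 0 ≤ cA) (hcB : 0 ≤ cB) (hc₁ : 0 ≤ c₁) (hr₀ : 0 < r₀) (hδ' : 0 ≤ δ')
    (hθ0 : 0 < θ) (hθ1 : θ < 1) (hθθ' : θ ≤ θ') (hθ'1 : θ' ≤ 1) (hω : 0 < S.D.ω) (hω1 : S.D.ω < 1)
    (hh : cA * (EA₀ + E₀) < 1 - S.D.ω)
    (hsmall : S.D.ω + G * cA * (1 - S.D.ω) / (1 - S.D.ω - cA * (EA₀ + E₀)) < θ') :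
    ∃ C₅, NE5 (outA (readAtSlots S ι) E₀ cB) (outB (readAtSlots S ι) E₀ cB) W κ θ' C₅ :=
  exists_ne5_of_record (readAtSlots S ι) E₀ cB (transportReads_record_readAt S ι W) hbB hbA hdA hdB hRA hRB hwer hfl hins hbd
    hbud hline hOp hHist hE₀ hG hcA hcB hc₁ hr₀ hδ' hθ0 hθ1 hθθ' hθ'1 hω hω1 hh hsmall

/-- [folklore] **PER PAIR OF RUNS, W4 PRODUCED, READING DISCHARGED**: leaf-10-g3's `exists_ne5_of_record_insOp` at the slot
package read at transport — the insertion species' displayed one-run envelope ∕ bound and two-run rate (`Gi`, `δI`) replace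
W4's `δ′`; NO `TransportReads` binder. -/
theorem exists_ne5_of_record_insOp_readAt [CompleteSpace Hist] [NormedAddCommGroup IOp] [NormedSpace ℂ IOp]
    {W : Set (ℕ → ℝ)} {ROp RHist : ℕ → ℝ} {a : ℕ → TermIdx R.carriers.Dom (Bnd R) → ℝ}
    {κ G EA₀ cA c₁ r₀ Gi δI θ θ' : ℝ} (rI : ℕ → ℝ) (hrI : ∀ k, 0 < rI k)
    (hbB : (assembly (readAtSlots S ι)).SliceBudgetB W κ cB)
    (hbA : (readAtSlots S ι).D.SliceBudget (step (readAtSlots S ι) E₀ cB) W κ cA)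
    (hdA : DecayBound (outA (readAtSlots S ι) E₀ cB) W EA₀ κ) (hdB : DecayBound (outB (readAtSlots S ι) E₀ cB) W E₀ κ)
    (hRA : RawBounded S.F (assembly (readAtSlots S ι)).rawAt W) (hRB : RawBounded S.F S.rawB W)
    (hwer : WeightedEntrywiseRate S.F (assembly (readAtSlots S ι)).rawAt S.rawB W c₁ fun k => θ ^ k) (hfl : ∀ k, r₀ ≤ S.rOp k)
    (hienv : ((readAtSlots S ι).D.toInsOpModel (step (readAtSlots S ι) E₀ cB) rI hrI).InsOpEnvelope W κ E₀ Gi)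
    (hibdA : ((readAtSlots S ι).D.toInsOpModel (step (readAtSlots S ι) E₀ cB) rI hrI).InsBoundA W κ E₀ Gi)
    (hirate : ((readAtSlots S ι).D.toInsOpModel (step (readAtSlots S ι) E₀ cB) rI hrI).InsOpRate W δI θ)
    (hδI : 0 ≤ δI) (hGi : 0 ≤ Gi)
    (hbd : TermBound (ballClass (selfCtr (assembly (readAtSlots S ι)).raw (assembly (readAtSlots S ι)).histRef) ROp RHist)
      (term (assembly S).𝒯 (assembly S).inc S.act) W κ a)
    (hbud : TermBudget a G)
    (hline : TermLineAnalytic (ballClass (selfCtr (assembly (readAtSlots S ι)).raw (assembly (readAtSlots S ι)).histRef) ROp RHist)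
      (term (assembly S).𝒯 (assembly S).inc S.act) W)
    (hOp : ∀ k, S.rOp k ≤ ROp k) (hHist : ∀ k, (assembly S).bHist E₀ cB k + S.rHist k ≤ RHist k)
    (hE₀ : 0 ≤ E₀) (hG : 0 ≤ G) (hcA : 0 ≤ cA) (hcB : 0 ≤ cB) (hc₁ : 0 ≤ c₁) (hr₀ : 0 < r₀)
    (hθ0 : 0 < θ) (hθ1 : θ < 1) (hθθ' : θ ≤ θ') (hθ'1 : θ' ≤ 1) (hω : 0 < S.D.ω) (hω1 : S.D.ω < 1)
    (hh : cA * (EA₀ + E₀) < 1 - S.D.ω)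
    (hsmall : S.D.ω + G * cA * (1 - S.D.ω) / (1 - S.D.ω - cA * (EA₀ + E₀)) < θ') :
    ∃ C₅, NE5 (outA (readAtSlots S ι) E₀ cB) (outB (readAtSlots S ι) E₀ cB) W κ θ' C₅ :=
  exists_ne5_of_record_insOp (readAtSlots S ι) E₀ cB rI hrI (transportReads_record_readAt S ι W) hbB hbA hdA hdB hRA hRB hwer
    hfl hienv hibdA hirate hδI hGi hbd hbud hline hOp hHist hE₀ hG hcA hcB hc₁ hr₀ hθ0 hθ1 hθθ' hθ'1 hω hω1 hh hsmall

omit S ι E₀ cB in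
/-- [folklore] **UNIFORM IN THE PAIR OF RUNS, READING DISCHARGED**: leaf-10-g3's `uniform_ne5_of_record` restricted to slot
packages READ AT TRANSPORT — ONE constant `C₅` (from the displayed sizes only) serves every pair of runs `R`, every slot package
`S` with `S.D.ω = ω`, every run-A insertion-operator datum `ι`, every window and roomy class; the binder list is that of
`uniform_ne5_of_record` MINUS `TransportReads`. -/
theorem uniform_ne5_of_record_readAt {κ G EA₀ E₀ cA cB c₁ r₀ δ' θ θ' ω : ℝ}
    (hE₀ : 0 ≤ E₀) (hG : 0 ≤ G) (hcA : 0 ≤ cA) (hcB : 0 ≤ cB) (hc₁ : 0 ≤ c₁) (hr₀ : 0 < r₀) (hδ' : 0 ≤ δ')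
    (hθ0 : 0 < θ) (hθ1 : θ < 1) (hθθ' : θ ≤ θ') (hθ'1 : θ' ≤ 1) (hω : 0 < ω) (hω1 : ω < 1)
    (hh : cA * (EA₀ + E₀) < 1 - ω) (hsmall : ω + G * cA * (1 - ω) / (1 - ω - cA * (EA₀ + E₀)) < θ') :
    ∃ C₅ : ℝ, ∀ {𝔾 : Type} [GaugeGroup 𝔾] {R : TwoRuns 𝔾} {E IOp Hist : Type*} [NormedAddCommGroup Hist] [NormedSpace ℂ Hist]
      (S : Slots R E IOp Hist) (ι : (ℕ → ℝ) → R.carriers.BgA → ℕ → IOp) {W : Set (ℕ → ℝ)} {ROp RHist : ℕ → ℝ}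
      {a : ℕ → TermIdx R.carriers.Dom (Bnd R) → ℝ},
      S.D.ω = ω →
      (assembly (readAtSlots S ι)).SliceBudgetB W κ cB →
      (readAtSlots S ι).D.SliceBudget (step (readAtSlots S ι) E₀ cB) W κ cA →
      DecayBound (outA (readAtSlots S ι) E₀ cB) W EA₀ κ → DecayBound (outB (readAtSlots S ι) E₀ cB) W E₀ κ →
      RawBounded S.F (assembly (readAtSlots S ι)).rawAt W → RawBounded S.F S.rawB W →
      WeightedEntrywiseRate S.F (assembly (readAtSlots S ι)).rawAt S.rawB W c₁ (fun k => θ ^ k) → (∀ k, r₀ ≤ S.rOp k) →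
      (step (readAtSlots S ι) E₀ cB).InsertionRate W κ E₀ δ' θ →
      TermBound (ballClass (selfCtr (assembly (readAtSlots S ι)).raw (assembly (readAtSlots S ι)).histRef) ROp RHist)
        (term (assembly S).𝒯 (assembly S).inc S.act) W κ a →
      TermBudget a G →
      TermLineAnalytic (ballClass (selfCtr (assembly (readAtSlots S ι)).raw (assembly (readAtSlots S ι)).histRef) ROp RHist)
        (term (assembly S).𝒯 (assembly S).inc S.act) W →
      (∀ k, S.rOp k ≤ ROp k) → (∀ k, (assembly S).bHist E₀ cB k + S.rHist k ≤ RHist k) →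
      NE5 (outA (readAtSlots S ι) E₀ cB) (outB (readAtSlots S ι) E₀ cB) W κ θ' C₅ := by
  obtain ⟨C₅, h⟩ := uniform_ne5_of_record (κ := κ) hE₀ hG hcA hcB hc₁ hr₀ hδ' hθ0 hθ1 hθθ' hθ'1 hω hω1 hh hsmall
  exact ⟨C₅, fun S ι _ _ _ _ hSω hbB hbA hdA hdB hRA hRB hwer hfl hins hbd hbud hline hOp hHist =>
    h (readAtSlots S ι) hSω (transportReads_record_readAt S ι _) hbB hbA hdA hdB hRA hRB hwer hfl hins hbd hbud hline hOp hHist⟩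

end OfRecord

end Summit.QuantumFields.BalabanUV.T4Continuum.B13StepOfRecordReadAt

end
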